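/-
Copyright (c) 2026 the pub-hodgecm-mathlib formalisation cell (harness21).  Prover seat hodgecm-mathlib-K2E3-p12 (g5) (E3 §L lead on loan to E1 by the CHAIR WORD
«β → E1» 2026-09-04T06:25Z), Track B ∕ K2-LIT, h413 = `stmt-HodgeConjecture-24833`, line `K2_E1_TraceFormulaBeta`, campaign «EIS-RANK-ONE» rung R6h;
DEAL (R6h-b) of the dealer K2E1-plan (g4) 2026-09-04T06:36:29Z: THE EXTRACTION LETTER — from the complex four-term Maass–Selberg right-hand side ON THE DIAGONAL to the real
inequality of ★ p857974, for BOTH ranks (`s₁ = 2x`, `s₂ = 2iy`).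
-/
import Summits.HodgeConjecture.HodgeConjecture.Theorems.K2E1MaassSelbergPoleInequality   -- ★ p857974 (this seat): (a1)–(a4) from the real diagonal inequality
import HarnessLib

/-!
# K2·E1 — `K2E1MaassSelbergPoleControl`: THE (a, b, c)-EXTRACTION FROM THE DIAGONAL FOUR-TERM FORMULA, AND POLE CONTROL IN BRACKET CURRENCY
# (campaign «EIS-RANK-ONE», rung R6h-b, generic half: one letter for `N = 2` (`s₁ = z + conj z − 1`) and `N = 3` (`s₁ = z + conj z − 2`))

Track B ∕ K2-LIT, crux h413 = `stmt-HodgeConjecture-24833`, route of record `HCCMUnconditional`; cell `hodgecm-mathlib`, squad K2, ENGINE E1.  Prover seat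
`hodgecm-mathlib-K2E3-p12` (g5) on loan; DEAL (R6h-b) of the dealer K2E1-plan (g4) 2026-09-04T06:36:29Z («coordinate the (a,b,c) extraction letter with K2E4-p10 (g4) so
N = 2∕3 read the same»).  THEOREMS ONLY (no `def`, no `instance`, no notation, no named-fact hypothesis, no `sorry`); lane `--supports stmt-HodgeConjecture-24833 --as helper`
(count-neutral).  Closes no socket; no automorphic import (pure complex∕real algebra over ★ p857974).

THE MATHEMATICS [MoeglinWaldspurger1995, IV.2.3, IV.3.12; Arthur1980TraceFormulaII, §4; Garrett2018, §1.12].  The Maass–Selberg relation of record (★ `K2E1MaassSelbergUTwo` ∕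
★ p857851 at `N = 2`, ★ p857614∕p857703∕p857832 at `N = 3`) has the right-hand side
`c_μ·(K·((T^{s₁}∕s₁)·[Ξ₁] + (T^{s₂}∕s₂)·[Ξ₂] − (T^{−s₂}∕s₂)·[Ξ₃] − (T^{−s₁}∕s₁)·[Ξ₄]))`, `s₁ = z + conj z′ − 2ρ_H`, `s₂ = z − conj z′`.  ON THE DIAGONAL `z′ = z`:
`s₁ = 2x` (`x = Re z − ρ_H > 0`), `s₂ = 2iy` (`y = Im z`), `[Ξ₁] = a ≥ 0` and `[Ξ₄] = b ≥ 0` are REAL (norms²), `[Ξ₃] = conj [Ξ₂]`, `|[Ξ₂]|² ≤ a·b` (Cauchy–Schwarz), and the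
left-hand side is the real number `Q = ‖Λ^T E(φ,z)‖²_X ≥ 0`.
* §1 `cpow_neg_mul_I_eq_conj`, `oscillatory_pair_eq_ofReal` — `T^{−2iy} = conj(T^{2iy})` and `(T^{s₂}∕s₂)·W − (T^{−s₂}∕s₂)·conj W = Im(T^{2iy}·W)∕y` (a REAL number).
* §2 **`maassSelbergDiag_of_fourTerm`** — THE LETTER: the complex identity `(Q : ℂ) = c₁·(c₂·(four terms))` with `c₁, c₂ > 0`, `Q ≥ 0` yields the real inequality
  `0 ≤ a·T^{2x}∕(2x) − b·T^{−2x}∕(2x) + c`, `c := Im(W·T^{2iy})∕y`, and `|c| ≤ √(ab)∕|y|` from `‖W‖² ≤ a·b` (★ p857974 §1).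
* §3 **`poleControl_of_fourTerm`** — COROLLARY in bracket currency: (a1) `√b ≤ …`, (a2) uniform bound on boxes off the real axis, (a3) `b ≤ C∕y²` for `0 < |y| ≤ 1`
  (★ p857974 (a1)–(a3) applied to the extracted `(a, b, c)`).
The JUNCTION files (R6h-b)_two ∕ (R6h-b) N = 3 only have to (i) specialise the relation of record to `φ′ = φ`, `z′ = z` (★ diagonal p857918 ∕ (R6g-b)_two), (ii) show
`[Ξ₁], [Ξ₄]` real `≥ 0`, `[Ξ₃] = conj [Ξ₂]`, `|[Ξ₂]|² ≤ [Ξ₁]·[Ξ₄]` for the torus∕`K_U`-averaged brackets, and (iii) call §2∕§3 with `x = Re z − ρ_H`.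
HONEST LABEL: HC_CM is proved only modulo the 7 printed citations (2 remaining named inputs: hLiu418 = `stmt-HodgeConjecture-24832`, h413 = `stmt-HodgeConjecture-24833`)
until rung 0 closes; this file asserts no named fact and closes no socket.
References: [MoeglinWaldspurger1995] IV.2.3, IV.3.12 · [Arthur1980TraceFormulaII] §4 · [Garrett2018] §1.12.
-/

set_option autoImplicit false
-- the mandated namespace repeats the single-problem summit's segment (`HodgeConjecture.HodgeConjecture`)
set_option linter.dupNamespace false

noncomputable section

open Filter Topology Set
open scoped ComplexConjugate
open Summit.HodgeConjecture.HodgeConjecture.Cruxes.H413.K2E1MaassSelbergPoleInequality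

namespace Summit.HodgeConjecture.HodgeConjecture.Cruxes.H413.K2E1MaassSelbergPoleControl

/-! ## §1  The oscillatory pair on the diagonal -/

/-- `conj (T^s) = T^{conj s}` for real `T > 0`. [folklore] -/
theorem conj_ofReal_cpow {T : ℝ} (hT : 0 < T) (s : ℂ) : conj ((T : ℂ) ^ s) = (T : ℂ) ^ (conj s) := by
  have harg : ((T : ℂ)).arg ≠ Real.pi := by
    rw [Complex.arg_ofReal_of_nonneg hT.le]; exact Real.pi_pos.ne
  rw [Complex.cpow_conj _ _ harg, Complex.conj_ofReal]

/-- `T^{−(2y)i} = conj (T^{(2y)i})` for real `T > 0`, `y : ℝ`. [folklore] -/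
theorem cpow_neg_mul_I_eq_conj {T : ℝ} (hT : 0 < T) (t : ℝ) :
    (T : ℂ) ^ (-((t : ℂ) * Complex.I)) = conj ((T : ℂ) ^ ((t : ℂ) * Complex.I)) := by
  rw [conj_ofReal_cpow hT, map_mul, Complex.conj_ofReal, Complex.conj_I, mul_neg]

/-- **The oscillatory pair is real**: `(u∕s₂)·W − (conj u∕s₂)·conj W = Im(u·W)∕y` for `s₂ = (2y)·i`, `y ≠ 0` (`u = T^{2iy}`).
[cite: MoeglinWaldspurger1995, IV.3.12] -/
theorem oscillatory_pair_eq_ofReal (u W : ℂ) {y : ℝ} (hy : y ≠ 0) :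
    u / (((2 * y : ℝ) : ℂ) * Complex.I) * W - conj u / (((2 * y : ℝ) : ℂ) * Complex.I) * conj W = (((u * W).im / y : ℝ) : ℂ) := by
  have h2y : ((2 * y : ℝ) : ℂ) * Complex.I ≠ 0 :=
    mul_ne_zero (by exact_mod_cast (mul_ne_zero two_ne_zero hy)) Complex.I_ne_zero
  have hy' : (y : ℂ) ≠ 0 := by exact_mod_cast hy
  rw [div_mul_eq_mul_div, div_mul_eq_mul_div, ← sub_div, ← map_mul, Complex.sub_conj, div_eq_iff h2y]
  push_cast
  field_simp

/-! ## §2  The extraction letter -/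

/-- **THE (a, b, c)-EXTRACTION LETTER (both ranks).**  Let `c₁, c₂ > 0`, `T > 0`, `y ≠ 0`, `Q ≥ 0` real (any real `x`; `x > 0` in the applications), `a, b : ℝ`, `W : ℂ`, and suppose the DIAGONAL
four-term identity `(Q : ℂ) = c₁·(c₂·((T^{s₁}∕s₁)·a + (T^{s₂}∕s₂)·W − (T^{−s₂}∕s₂)·conj W − (T^{−s₁}∕s₁)·b))` with `s₁ = 2x`, `s₂ = (2y)i` (the relation of record at
`z′ = z` after `[Ξ₁] = a`, `[Ξ₄] = b`, `[Ξ₃] = conj [Ξ₂]`).  THEN the real Maass–Selberg inequality of ★ p857974 holds: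
`0 ≤ a·T^{2x}∕(2x) − b·T^{−2x}∕(2x) + Im(W·T^{2iy})∕y`. [cite: MoeglinWaldspurger1995, IV.2.3, IV.3.12] [cite: Arthur1980TraceFormulaII, §4] -/
theorem maassSelbergDiag_of_fourTerm {a b Q c₁ c₂ T x y : ℝ} {W B₁ B₃ B₄ s₁ s₂ : ℂ}
    (hc₁ : 0 < c₁) (hc₂ : 0 < c₂) (hT : 0 < T) (hy : y ≠ 0) (hQ : 0 ≤ Q)
    (hs₁ : s₁ = ((2 * x : ℝ) : ℂ)) (hs₂ : s₂ = ((2 * y : ℝ) : ℂ) * Complex.I) (hB₁ : B₁ = (a : ℂ)) (hB₃ : B₃ = conj W) (hB₄ : B₄ = (b : ℂ))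
    (hfour : (Q : ℂ) = (c₁ : ℂ) * ((c₂ : ℂ) *
      ((T : ℂ) ^ s₁ / s₁ * B₁ + (T : ℂ) ^ s₂ / s₂ * W - (T : ℂ) ^ (-s₂) / s₂ * B₃ - (T : ℂ) ^ (-s₁) / s₁ * B₄))) :
    0 ≤ a * T ^ (2 * x) / (2 * x) - b * T ^ (-(2 * x)) / (2 * x) + (W * (T : ℂ) ^ (((2 * y : ℝ) : ℂ) * Complex.I)).im / y := by
  subst hs₁ hs₂ hB₁ hB₃ hB₄
  -- the four terms as real numbers
  have h1 : (T : ℂ) ^ ((2 * x : ℝ) : ℂ) / ((2 * x : ℝ) : ℂ) * (a : ℂ) = ((T ^ (2 * x) / (2 * x) * a : ℝ) : ℂ) := by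
    rw [← Complex.ofReal_cpow hT.le]; push_cast; ring
  have h4 : (T : ℂ) ^ (-((2 * x : ℝ) : ℂ)) / ((2 * x : ℝ) : ℂ) * (b : ℂ) = ((T ^ (-(2 * x)) / (2 * x) * b : ℝ) : ℂ) := by
    rw [← Complex.ofReal_neg, ← Complex.ofReal_cpow hT.le]; push_cast; ring
  have h23 : (T : ℂ) ^ (((2 * y : ℝ) : ℂ) * Complex.I) / (((2 * y : ℝ) : ℂ) * Complex.I) * W -
      (T : ℂ) ^ (-(((2 * y : ℝ) : ℂ) * Complex.I)) / (((2 * y : ℝ) : ℂ) * Complex.I) * conj W =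
      (((((T : ℂ) ^ (((2 * y : ℝ) : ℂ) * Complex.I)) * W).im / y : ℝ) : ℂ) := by
    rw [cpow_neg_mul_I_eq_conj hT]
    exact oscillatory_pair_eq_ofReal _ W hy
  -- reassemble: the right-hand side is the real number `c₁·(c₂·E)`
  have hsum : (T : ℂ) ^ ((2 * x : ℝ) : ℂ) / ((2 * x : ℝ) : ℂ) * (a : ℂ) + (T : ℂ) ^ (((2 * y : ℝ) : ℂ) * Complex.I) / (((2 * y : ℝ) : ℂ) * Complex.I) * W -
        (T : ℂ) ^ (-(((2 * y : ℝ) : ℂ) * Complex.I)) / (((2 * y : ℝ) : ℂ) * Complex.I) * conj W - (T : ℂ) ^ (-((2 * x : ℝ) : ℂ)) / ((2 * x : ℝ) : ℂ) * (b : ℂ) =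
      ((T ^ (2 * x) / (2 * x) * a + ((T : ℂ) ^ (((2 * y : ℝ) : ℂ) * Complex.I) * W).im / y - T ^ (-(2 * x)) / (2 * x) * b : ℝ) : ℂ) := by
    rw [show ∀ A B C D : ℂ, A + B - C - D = A + (B - C) - D from fun A B C D => by ring, h1, h23, h4]
    push_cast
    ring
  rw [hsum] at hfour
  have hreal : Q = c₁ * (c₂ * (T ^ (2 * x) / (2 * x) * a + ((T : ℂ) ^ (((2 * y : ℝ) : ℂ) * Complex.I) * W).im / y - T ^ (-(2 * x)) / (2 * x) * b)) := by
    exact_mod_cast hfour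
  have hE : 0 ≤ T ^ (2 * x) / (2 * x) * a + ((T : ℂ) ^ (((2 * y : ℝ) : ℂ) * Complex.I) * W).im / y - T ^ (-(2 * x)) / (2 * x) * b := by
    have := hQ
    rw [hreal] at this
    exact nonneg_of_mul_nonneg_right (nonneg_of_mul_nonneg_right this hc₁) hc₂
  have key : a * T ^ (2 * x) / (2 * x) - b * T ^ (-(2 * x)) / (2 * x) + ((T : ℂ) ^ (((2 * y : ℝ) : ℂ) * Complex.I) * W).im / y =
      T ^ (2 * x) / (2 * x) * a + ((T : ℂ) ^ (((2 * y : ℝ) : ℂ) * Complex.I) * W).im / y - T ^ (-(2 * x)) / (2 * x) * b := by ring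
  rw [mul_comm W, key]
  exact hE

/-! ## §3  Pole control in bracket currency -/

/-- **POLE CONTROL FROM THE DIAGONAL FOUR-TERM FORMULA (both ranks).**  Under the hypotheses of §2 plus `a > 0`, `b ≥ 0`, `‖W‖² ≤ a·b`, `T ≥ 1`:
(a1) `√b ≤ x·T^{2x}·√a∕|y| + √(x²·T^{4x}·a∕y² + a·T^{4x})`; (a2) on `x ∈ [x₁,x₂]` (`x₁ > 0`), `|y| ≥ η > 0`:
`b ≤ (x₂·T^{2x₂}·√a∕η + √(x₂²·T^{4x₂}·a∕η² + a·T^{4x₂}))²` («no pole off the real axis»); (a3) for `0 < |y| ≤ 1`: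
`b ≤ (x·T^{2x}·√a + √(x²·T^{4x}·a + a·T^{4x}))²∕y²` («order ≤ 1 at real points»). [cite: MoeglinWaldspurger1995, IV.3.12 (a)] [cite: Garrett2018, §1.12] -/
theorem poleControl_of_fourTerm {a b Q c₁ c₂ T x y : ℝ} {W B₁ B₃ B₄ s₁ s₂ : ℂ}
    (hc₁ : 0 < c₁) (hc₂ : 0 < c₂) (hT : 1 ≤ T) (hx : 0 < x) (hy : y ≠ 0) (hQ : 0 ≤ Q) (ha : 0 < a) (hb : 0 ≤ b) (hW : ‖W‖ ^ 2 ≤ a * b)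
    (hs₁ : s₁ = ((2 * x : ℝ) : ℂ)) (hs₂ : s₂ = ((2 * y : ℝ) : ℂ) * Complex.I) (hB₁ : B₁ = (a : ℂ)) (hB₃ : B₃ = conj W) (hB₄ : B₄ = (b : ℂ))
    (hfour : (Q : ℂ) = (c₁ : ℂ) * ((c₂ : ℂ) *
      ((T : ℂ) ^ s₁ / s₁ * B₁ + (T : ℂ) ^ s₂ / s₂ * W - (T : ℂ) ^ (-s₂) / s₂ * B₃ - (T : ℂ) ^ (-s₁) / s₁ * B₄))) :
    Real.sqrt b ≤ x * T ^ (2 * x) * Real.sqrt a / |y| + Real.sqrt (x ^ 2 * T ^ (4 * x) * a / y ^ 2 + a * T ^ (4 * x)) ∧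
      (∀ {x₁ x₂ η : ℝ}, 0 < x₁ → x ∈ Set.Icc x₁ x₂ → 0 < η → η ≤ |y| →
        b ≤ (x₂ * T ^ (2 * x₂) * Real.sqrt a / η + Real.sqrt (x₂ ^ 2 * T ^ (4 * x₂) * a / η ^ 2 + a * T ^ (4 * x₂))) ^ 2) ∧
      (|y| ≤ 1 → b ≤ (x * T ^ (2 * x) * Real.sqrt a + Real.sqrt (x ^ 2 * T ^ (4 * x) * a + a * T ^ (4 * x))) ^ 2 / y ^ 2) := by
  have hT0 : 0 < T := lt_of_lt_of_le one_pos hT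
  have hMS := maassSelbergDiag_of_fourTerm hc₁ hc₂ hT0 hy hQ hs₁ hs₂ hB₁ hB₃ hB₄ hfour
  have hc : |(W * (T : ℂ) ^ (((2 * y : ℝ) : ℂ) * Complex.I)).im / y| ≤ Real.sqrt (a * b) / |y| :=
    abs_im_mul_div_le (le_of_eq (norm_ofReal_cpow_mul_I hT0 _)) hW y
  exact ⟨sqrt_le_of_maassSelbergDiag ha hb hT hx hy hc hMS,
    fun hx₁ hxI hη hyη => le_of_maassSelbergDiag_of_mem_box ha hb hT hx₁ hxI hη hyη hc hMS,
    fun hy1 => le_div_sq_of_maassSelbergDiag ha hb hT hx hy hy1 hc hMS⟩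

end Summit.HodgeConjecture.HodgeConjecture.Cruxes.H413.K2E1MaassSelbergPoleControl

end
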